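import Literature.Analysis.FluidPDE.CKNDuhamelTerms
import Literature.Analysis.FluidPDE.CKNDuhamelSetup
import Literature.Analysis.FluidPDE.CKNMorreyDualIdentity
import HarnessLib

/-!
# The localised Duhamel formula of Lemma 13.6, tested: `∫ θ u_k = ∑ ∫ θ · (forward potentials)`

Analysis/FluidPDE support file (everything proved, no definitions) in the decomposition of the
named fact `Literature.Analysis.FluidPDE.LemarieRieusset2016.lemma13_6_duhamel`
(`CKNMorreyHolder.lean`: Lemarié-Rieusset 2016, §13.9 Step 3, (13.50)–(13.52) pp. 474–475, and
the proof of Lemma 13.6 pp. 477–478). For a distributional solution `(u, p)` of the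
Navier–Stokes equations with divergence-free force `f` on `Ω ⊇ Q_{r₂}(z₀)`, a product cut-off
`φ` flat on the inner ball, measurable modifications `ũ, p̃, f̃` of the data, and every test
function `θ` supported in the inner cylinder `Q_{r_N}(z₀)`, the pairing `∫ θ ũ_k` equals the sum
of the pairings of `θ` with **explicit forward potentials** of the localised data: heat potentials
`W₊ ⊛ F` (`F ∈ {(∂ₜφ+νΔφ)ũ_k, ∂ᵢφ ũᵢũ_k, φf̃_k, ∂_kλ-smeared φp̃, profile-smeared φũᵢũⱼ}`),
multiplier potentials `-Re σ(D)W₊ ⊛ F` (`σ ∈ {2πiξᵢ, 2πiξⱼξᵢξ_k/|ξ|²}`,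
`F ∈ {2ν∂ᵢφ ũ_k, φũᵢũ_k, -φũᵢũⱼ}`), and the far-field potentials `∫ Ǩ(w - z) F(z) dz` of the
annulus data against the reflected backward kernels of the heat, `∂_k e^{νaΔ}Γ₀` and
`∂ᵢ∂_k e^{νaΔ}Γ₀` families (`duhamel_pairing_identity`). This is the duality identity
`CKNMorreyDualIdentity.integral_cutoff_mul_test_mul_inner_eq_nu` (with `g = θ`) followed, term
by term, by the conversions of `CKNDuhamelTerms.lean`.

## References

* P. G. Lemarié-Rieusset, *The Navier–Stokes Problem in the 21st Century*, CRC Press (2016),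
  §13.9 Step 3, (13.50)–(13.52) pp. 474–475; Lemma 13.6 proof pp. 477–478. [LemarieRieusset2016]
-/

noncomputable section

open MeasureTheory Set Function Filter Metric Real ContinuousLinearMap TopologicalSpace
open scoped ENNReal NNReal Topology RealInnerProductSpace Convolution Laplacian

namespace Literature.Analysis.FluidPDE

variable {Ω : Opens (ℝ × EuclideanSpace ℝ (Fin 3))} {ν : ℝ}
  {f u : ℝ → EuclideanSpace ℝ (Fin 3) → EuclideanSpace ℝ (Fin 3)}
  {p : ℝ → EuclideanSpace ℝ (Fin 3) → ℝ}
  {φ θ : ℝ → EuclideanSpace ℝ (Fin 3) → ℝ}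
  {ut ft : ℝ × EuclideanSpace ℝ (Fin 3) → EuclideanSpace ℝ (Fin 3)}
  {pt : ℝ × EuclideanSpace ℝ (Fin 3) → ℝ}
  {z₀ : ℝ × EuclideanSpace ℝ (Fin 3)} {rN ρ₁ a₀ b₀ r₀ r₁ : ℝ}

/-- Integrability on the whole space of a continuous coefficient supported in a compact `K` times
data integrable on `K`. [folklore] -/
theorem integrable_coeff_mul {K : Set (ℝ × EuclideanSpace ℝ (Fin 3))} (hK : IsCompact K)
    {T m : ℝ × EuclideanSpace ℝ (Fin 3) → ℝ} (hT : Continuous T) (hT0 : ∀ z, z ∉ K → T z = 0)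
    (hm : IntegrableOn m K volume) : Integrable (fun z => T z * m z) volume := by
  have h := integrableOn_test_mul_mul (⊤ : Opens (ℝ × EuclideanSpace ℝ (Fin 3))) hK hT hT0 hm
    continuous_const (X := fun _ => (1 : ℝ))
  have h' : IntegrableOn (fun z => T z * m z) (univ : Set (ℝ × EuclideanSpace ℝ (Fin 3))) volume := by
    refine (h.congr_fun (fun z _ => ?_) MeasurableSet.univ)
    ring
  exact integrableOn_univ.1 h'

set_option maxHeartbeats 800000 in
/-- **The localised Duhamel formula, tested against `θ`.** See the module docstring. [folklore] -/
theorem duhamel_pairing_identity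
    (hns : IsDistributionalNSSolutionOn Ω ν f u p) (hν : 0 < ν)
    (hf : LocallyIntegrableOn (uncurry f) (Ω : Set (ℝ × EuclideanSpace ℝ (Fin 3))) volume)
    (hdivf : ∀ φ' : ℝ → EuclideanSpace ℝ (Fin 3) → ℝ, IsSpaceTimeTestOn Ω φ' →
      ∫ z in (Ω : Set (ℝ × EuclideanSpace ℝ (Fin 3))), ⟪f z.1 z.2, gradient (φ' z.1) z.2⟫ = 0)
    -- the cut-off
    (hφT : IsSpaceTimeTestOn (⊤ : Opens (ℝ × EuclideanSpace ℝ (Fin 3))) φ)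
    (hKΩ : tsupport (uncurry φ) ⊆ (Ω : Set (ℝ × EuclideanSpace ℝ (Fin 3))))
    (hKt : ∀ z ∈ tsupport (uncurry φ), z.1 ∈ Icc a₀ b₀)
    (hrN : 0 < rN) (hρ₁ : rN < ρ₁)
    (hQΩ : FluidPDE.parabolicCylinderCentered rN z₀ ⊆ (Ω : Set (ℝ × EuclideanSpace ℝ (Fin 3))))
    (hone : ∀ z : ℝ × EuclideanSpace ℝ (Fin 3), |z.1 - z₀.1| < ρ₁ ^ 2 → dist z.2 z₀.2 < ρ₁ → φ z.1 z.2 = 1)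
    (hflat : ∀ (t : ℝ) (x : EuclideanSpace ℝ (Fin 3)), dist x z₀.2 < ρ₁ →
      fderiv ℝ (φ t) x = 0 ∧ (Δ (φ t)) x = 0 ∧
        ∀ v w : EuclideanSpace ℝ (Fin 3), fderiv ℝ (fun y => fderiv ℝ (φ t) y v) x w = 0)
    -- the modifications
    (hutm : Measurable ut) (hptm : Measurable pt)
    (hut : ∀ᵐ z ∂(volume.restrict (Ω : Set (ℝ × EuclideanSpace ℝ (Fin 3)))), u z.1 z.2 = ut z)
    (hpt : ∀ᵐ z ∂(volume.restrict (Ω : Set (ℝ × EuclideanSpace ℝ (Fin 3)))), p z.1 z.2 = pt z)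
    (hft : ∀ᵐ z ∂(volume.restrict (Ω : Set (ℝ × EuclideanSpace ℝ (Fin 3)))), f z.1 z.2 = ft z)
    -- the Newton radii
    (h₀ : 0 < r₀) (h₁ : r₀ < r₁)
    -- the component and the test function
    (k : Fin 3) (hθ : IsSpaceTimeTestOn (FluidPDE.parabolicCylinderCenteredOpens rN z₀) θ) :
    ∫ z : ℝ × EuclideanSpace ℝ (Fin 3), θ z.1 z.2 * ⟪ut z, EuclideanSpace.basisFun (Fin 3) ℝ k⟫ =
      -- T1
      (∫ w : ℝ × EuclideanSpace ℝ (Fin 3), θ w.1 w.2 * heatPotential ν (fun z : ℝ × EuclideanSpace ℝ (Fin 3) =>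
          (timeDeriv φ z.1 z.2 + ν * (Δ (φ z.1)) z.2) * ⟪ut z, EuclideanSpace.basisFun (Fin 3) ℝ k⟫) w)
      -- T2
      + (∑ i, ∫ w : ℝ × EuclideanSpace ℝ (Fin 3), θ w.1 w.2 *
          (-(multiplierHeatPotential ν (derivSymbol (EuclideanSpace.basisFun (Fin 3) ℝ i))
            (fun z : ℝ × EuclideanSpace ℝ (Fin 3) => (2 * ν * fderiv ℝ (φ z.1) z.2 (EuclideanSpace.basisFun (Fin 3) ℝ i)) *
              ⟪ut z, EuclideanSpace.basisFun (Fin 3) ℝ k⟫) w).re))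
      -- T3
      + (∑ i, ∫ w : ℝ × EuclideanSpace ℝ (Fin 3), θ w.1 w.2 * heatPotential ν (fun z : ℝ × EuclideanSpace ℝ (Fin 3) =>
          fderiv ℝ (φ z.1) z.2 (EuclideanSpace.basisFun (Fin 3) ℝ i) *
            (⟪ut z, EuclideanSpace.basisFun (Fin 3) ℝ i⟫ * ⟪ut z, EuclideanSpace.basisFun (Fin 3) ℝ k⟫)) w)
      -- T4
      + (∑ i, ∫ w : ℝ × EuclideanSpace ℝ (Fin 3), θ w.1 w.2 *
          (-(multiplierHeatPotential ν (derivSymbol (EuclideanSpace.basisFun (Fin 3) ℝ i))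
            (fun z : ℝ × EuclideanSpace ℝ (Fin 3) => φ z.1 z.2 *
              (⟪ut z, EuclideanSpace.basisFun (Fin 3) ℝ i⟫ * ⟪ut z, EuclideanSpace.basisFun (Fin 3) ℝ k⟫)) w).re))
      -- T5 (far field, heat family)
      + (∫ w : ℝ × EuclideanSpace ℝ (Fin 3), θ w.1 w.2 * ∫ z, (fun v => backKernel
          (fun a y => UnboundedOperators.heatKernel (E := EuclideanSpace ℝ (Fin 3)) (ν * a) y) (-v)) (w - z) *
            (fderiv ℝ (φ z.1) z.2 (EuclideanSpace.basisFun (Fin 3) ℝ k) * pt z))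
      -- T6
      + (∫ w : ℝ × EuclideanSpace ℝ (Fin 3), θ w.1 w.2 * heatPotential ν (fun z : ℝ × EuclideanSpace ℝ (Fin 3) =>
          φ z.1 z.2 * ⟪ft z, EuclideanSpace.basisFun (Fin 3) ℝ k⟫) w)
      -- T7 (the smooth part of the pressure)
      + (∫ w : ℝ × EuclideanSpace ℝ (Fin 3), θ w.1 w.2 * heatPotential ν (fun q : ℝ × EuclideanSpace ℝ (Fin 3) =>
          ∫ y, fderiv ℝ (newtonFarLaplacian r₀ r₁) (y - q.2) (EuclideanSpace.basisFun (Fin 3) ℝ k) *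
            (φ q.1 y * pt (q.1, y))) w)
      -- T8 (far field, `∂_k e^{νaΔ}Γ₀` family)
      + (∫ w : ℝ × EuclideanSpace ℝ (Fin 3), θ w.1 w.2 * ∫ z, (fun v => backKernel
          (fun a y => heatD1 (ν * a) (EuclideanSpace.basisFun (Fin 3) ℝ k) (newtonNear r₀ r₁) y) (-v)) (w - z) *
            ((-(Δ (φ z.1)) z.2) * pt z))
      -- T9 (far field, `∂ᵢ∂_k e^{νaΔ}Γ₀` family)
      + (∑ i, ∫ w : ℝ × EuclideanSpace ℝ (Fin 3), θ w.1 w.2 * ∫ z, (fun v => backKernel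
          (fun a y => heatD2 (ν * a) (EuclideanSpace.basisFun (Fin 3) ℝ i) (EuclideanSpace.basisFun (Fin 3) ℝ k)
            (newtonNear r₀ r₁) y) (-v)) (w - z) *
            ((-(2 * fderiv ℝ (φ z.1) z.2 (EuclideanSpace.basisFun (Fin 3) ℝ i))) * pt z))
      -- T10 (Calderón–Zygmund term: Oseen multiplier plus smooth remainder)
      + (∑ i, ∑ j, ∫ w : ℝ × EuclideanSpace ℝ (Fin 3), θ w.1 w.2 *
          (-(multiplierHeatPotential ν (oseenSymbol (EuclideanSpace.basisFun (Fin 3) ℝ j)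
              (EuclideanSpace.basisFun (Fin 3) ℝ i) (EuclideanSpace.basisFun (Fin 3) ℝ k))
            (fun z : ℝ × EuclideanSpace ℝ (Fin 3) => (-(φ z.1 z.2)) *
              (⟪ut z, EuclideanSpace.basisFun (Fin 3) ℝ i⟫ * ⟪ut z, EuclideanSpace.basisFun (Fin 3) ℝ j⟫)) w).re +
          heatPotential ν (fun q : ℝ × EuclideanSpace ℝ (Fin 3) =>
            ∫ y, newtonFarD3Profile r₀ r₁ (EuclideanSpace.basisFun (Fin 3) ℝ j) (EuclideanSpace.basisFun (Fin 3) ℝ i)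
              (EuclideanSpace.basisFun (Fin 3) ℝ k) (y - q.2) *
              ((-(φ q.1 y)) * (⟪ut (q.1, y), EuclideanSpace.basisFun (Fin 3) ℝ i⟫ *
                ⟪ut (q.1, y), EuclideanSpace.basisFun (Fin 3) ℝ j⟫))) w))
      -- T11 (far field, `∂_k e^{νaΔ}Γ₀` family)
      + (∑ i, ∑ j, ∫ w : ℝ × EuclideanSpace ℝ (Fin 3), θ w.1 w.2 * ∫ z, (fun v => backKernel
          (fun a y => heatD1 (ν * a) (EuclideanSpace.basisFun (Fin 3) ℝ k) (newtonNear r₀ r₁) y) (-v)) (w - z) *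
            ((-(fderiv ℝ (fun y => fderiv ℝ (φ z.1) y (EuclideanSpace.basisFun (Fin 3) ℝ i)) z.2
              (EuclideanSpace.basisFun (Fin 3) ℝ j))) *
              (⟪ut z, EuclideanSpace.basisFun (Fin 3) ℝ i⟫ * ⟪ut z, EuclideanSpace.basisFun (Fin 3) ℝ j⟫)))
      -- T12 (far field, `∂ᵢ∂_k e^{νaΔ}Γ₀` family)
      + (∑ i, ∑ j, ∫ w : ℝ × EuclideanSpace ℝ (Fin 3), θ w.1 w.2 * ∫ z, (fun v => backKernel
          (fun a y => heatD2 (ν * a) (EuclideanSpace.basisFun (Fin 3) ℝ i) (EuclideanSpace.basisFun (Fin 3) ℝ k)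
            (newtonNear r₀ r₁) y) (-v)) (w - z) *
            ((-(2 * fderiv ℝ (φ z.1) z.2 (EuclideanSpace.basisFun (Fin 3) ℝ j))) *
              (⟪ut z, EuclideanSpace.basisFun (Fin 3) ℝ j⟫ * ⟪ut z, EuclideanSpace.basisFun (Fin 3) ℝ i⟫))) := by
  classical
  /- ### notation and basic objects -/
  set b : OrthonormalBasis (Fin 3) ℝ (EuclideanSpace ℝ (Fin 3)) := EuclideanSpace.basisFun (Fin 3) ℝ
    with hb_def
  set c : EuclideanSpace ℝ (Fin 3) := b k with hc_def
  have hb1 : ∀ i, ‖b i‖ ≤ 1 := fun i => (b.orthonormal.1 i).le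
  have hc1 : ‖c‖ ≤ 1 := hb1 k
  set K : Set (ℝ × EuclideanSpace ℝ (Fin 3)) := tsupport (uncurry φ) with hK_def
  have hK : IsCompact K := hφT.hasCompactSupport
  have hφ : IsSpaceTimeTestOn Ω φ := ⟨hφT.contDiff, hφT.hasCompactSupport, hKΩ⟩
  have hΩm : MeasurableSet (Ω : Set (ℝ × EuclideanSpace ℝ (Fin 3))) := Ω.isOpen.measurableSet
  -- the test function
  have hg : IsSpaceTimeTestOn (⊤ : Opens (ℝ × EuclideanSpace ℝ (Fin 3))) θ := hθ.mono le_top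
  set Q₃ : Set (ℝ × EuclideanSpace ℝ (Fin 3)) := FluidPDE.parabolicCylinderCentered rN z₀ with hQ₃_def
  have hθQ₃ : ∀ t x, θ t x ≠ 0 → ((t, x) : ℝ × EuclideanSpace ℝ (Fin 3)) ∈ Q₃ := fun t x h =>
    hθ.tsupport_subset (subset_tsupport _ (show ((t, x) : ℝ × EuclideanSpace ℝ (Fin 3)) ∈
      support (uncurry θ) from h))
  -- spatial supports: the test function lives in the inner ball, the annulus data outside `B(x₀, ρ₁)`
  have hgA : ∀ t y, θ t y ≠ 0 → y ∈ ball z₀.2 rN := fun t y h => by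
    have := hθQ₃ t y h
    rw [hQ₃_def, FluidPDE.mem_parabolicCylinderCentered] at this
    exact this.2
  have hsep : ∀ a ∈ {y : EuclideanSpace ℝ (Fin 3) | ρ₁ ≤ dist y z₀.2}, ∀ a' ∈ ball z₀.2 rN,
      ρ₁ - rN ≤ ‖a - a'‖ := by
    intro a ha a' ha'
    rw [mem_setOf_eq, dist_eq_norm] at ha
    rw [mem_ball, dist_eq_norm] at ha'
    have h := norm_sub_le_norm_sub_add_norm_sub a a' z₀.2
    linarith
  have hδ : 0 < ρ₁ - rN := by linarith
  /- ### the caloric fields and the master identity -/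
  set η : ℝ → EuclideanSpace ℝ (Fin 3) → ℝ := heatDuhamelBack ν θ with hη_def
  set Ξ : ℝ → EuclideanSpace ℝ (Fin 3) → ℝ :=
    heatDuhamelBack ν (fun t y => fderiv ℝ (newtonNearPotential r₀ r₁ (θ t)) y c) with hΞ_def
  set L : ℝ → EuclideanSpace ℝ (Fin 3) → ℝ :=
    heatDuhamelBack ν (fun t y => newtonFarSmoothing r₀ r₁ (fun y' => fderiv ℝ (θ t) y' c) y) with hL_def
  obtain ⟨-, -, main⟩ := integral_cutoff_mul_test_mul_inner_eq_nu (c := c) hns hν hf hdivf hφ hg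
    h₀ h₁ b hη_def hΞ_def hL_def
  obtain ⟨hηs, hΞs, hLs⟩ := contDiff_uncurry_caloric_fields_nu (c := c) hν hg h₀ h₁ hη_def hΞ_def hL_def
  /- ### the left-hand side is `∫ θ ũ_c` -/
  have hLHS : ∫ z in (Ω : Set (ℝ × EuclideanSpace ℝ (Fin 3))), φ z.1 z.2 * θ z.1 z.2 * ⟪u z.1 z.2, c⟫ =
      ∫ z : ℝ × EuclideanSpace ℝ (Fin 3), θ z.1 z.2 * ⟪ut z, c⟫ := by
    have h1 : ∀ z : ℝ × EuclideanSpace ℝ (Fin 3),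
        φ z.1 z.2 * θ z.1 z.2 * ⟪u z.1 z.2, c⟫ = θ z.1 z.2 * ⟪u z.1 z.2, c⟫ := by
      intro z
      by_cases hz : θ z.1 z.2 = 0
      · rw [hz]; ring
      · have hzQ := hθQ₃ z.1 z.2 hz
        rw [hQ₃_def, FluidPDE.mem_parabolicCylinderCentered] at hzQ
        have hsq : rN ^ 2 < ρ₁ ^ 2 := by nlinarith
        rw [hone z (abs_sub_lt_iff.2 ⟨by linarith [hzQ.1.2], by linarith [hzQ.1.1]⟩) (hzQ.2.trans hρ₁), one_mul]
    simp_rw [h1]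
    have h2 : ∫ z in (Ω : Set (ℝ × EuclideanSpace ℝ (Fin 3))), θ z.1 z.2 * ⟪u z.1 z.2, c⟫ =
        ∫ z in (Ω : Set (ℝ × EuclideanSpace ℝ (Fin 3))), θ z.1 z.2 * ⟪ut z, c⟫ := by
      refine setIntegral_congr_ae hΩm ?_
      filter_upwards [(ae_restrict_iff' hΩm).1 hut] with z hz hzΩ
      rw [hz hzΩ]
    rw [h2]
    refine setIntegral_eq_integral_of_forall_compl_eq_zero fun z hz => ?_
    have : θ z.1 z.2 = 0 := by
      by_contra h
      exact hz (hQΩ (hθQ₃ z.1 z.2 h))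
    rw [this, zero_mul]
  rw [hLHS] at main
  rw [main]
  /- ### continuity of the factors -/
  have cφ : Continuous fun z : ℝ × EuclideanSpace ℝ (Fin 3) => φ z.1 z.2 := hφ.contDiff.continuous
  have cφt : Continuous fun z : ℝ × EuclideanSpace ℝ (Fin 3) => timeDeriv φ z.1 z.2 :=
    hφ.continuous_timeDeriv
  have cφΔ : Continuous fun z : ℝ × EuclideanSpace ℝ (Fin 3) => (Δ (φ z.1)) z.2 := by
    have h := ((hφ.isSmoothSpaceTimeOn univ).laplacian uniqueDiffOn_univ).continuousOn
    rw [univ_prod_univ, continuousOn_univ] at h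
    exact h
  have cφi : ∀ v : EuclideanSpace ℝ (Fin 3),
      Continuous fun z : ℝ × EuclideanSpace ℝ (Fin 3) => fderiv ℝ (φ z.1) z.2 v := fun v =>
    continuous_fderiv_slice_of_contDiff hφ.contDiff v
  have cφij : ∀ v w : EuclideanSpace ℝ (Fin 3), Continuous fun z : ℝ × EuclideanSpace ℝ (Fin 3) =>
      fderiv ℝ (fun y => fderiv ℝ (φ z.1) y v) z.2 w :=
    fun v w => hφ.continuous_fderiv_fderiv_slice v w
  have cη : Continuous fun z : ℝ × EuclideanSpace ℝ (Fin 3) => η z.1 z.2 := hηs.continuous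
  have cηi : ∀ v : EuclideanSpace ℝ (Fin 3),
      Continuous fun z : ℝ × EuclideanSpace ℝ (Fin 3) => fderiv ℝ (η z.1) z.2 v := fun v =>
    continuous_fderiv_slice_of_contDiff hηs v
  have cΞ : Continuous fun z : ℝ × EuclideanSpace ℝ (Fin 3) => Ξ z.1 z.2 := hΞs.continuous
  have cΞi : ∀ v : EuclideanSpace ℝ (Fin 3),
      Continuous fun z : ℝ × EuclideanSpace ℝ (Fin 3) => fderiv ℝ (Ξ z.1) z.2 v := fun v =>
    continuous_fderiv_slice_of_contDiff hΞs v
  have cΞij : ∀ v w : EuclideanSpace ℝ (Fin 3), Continuous fun z : ℝ × EuclideanSpace ℝ (Fin 3) =>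
      fderiv ℝ (fun y => fderiv ℝ (Ξ z.1) y v) z.2 w :=
    fun v w => continuous_fderiv_slice_of_contDiff (contDiff_uncurry_fderiv_slice_apply hΞs v) w
  have cL : Continuous fun z : ℝ × EuclideanSpace ℝ (Fin 3) => L z.1 z.2 := hLs.continuous
  /- ### vanishing of the cut-off factors: off `K`, and on the inner ball -/
  have zφ : ∀ z : ℝ × EuclideanSpace ℝ (Fin 3), z ∉ K → φ z.1 z.2 = 0 := fun z hz =>
    show uncurry φ z = 0 from image_eq_zero_of_notMem_tsupport hz
  have zφt : ∀ z : ℝ × EuclideanSpace ℝ (Fin 3), z ∉ K →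
      timeDeriv φ z.1 z.2 + ν * (Δ (φ z.1)) z.2 = 0 := fun z hz => by
    rw [IsSpaceTimeTestOn.timeDeriv_eq_zero_of_notMem hz, laplacian_slice_eq_zero_of_notMem_tsupport hz,
      mul_zero, add_zero]
  have zφi : ∀ (v : EuclideanSpace ℝ (Fin 3)) (z : ℝ × EuclideanSpace ℝ (Fin 3)), z ∉ K →
      fderiv ℝ (φ z.1) z.2 v = 0 := fun v z hz => by
    rw [IsSpaceTimeTestOn.fderiv_slice_eq_zero_of_notMem hz]; rfl
  have zφij : ∀ (v w : EuclideanSpace ℝ (Fin 3)) (z : ℝ × EuclideanSpace ℝ (Fin 3)), z ∉ K →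
      fderiv ℝ (fun y => fderiv ℝ (φ z.1) y v) z.2 w = 0 := fun v w z hz =>
    fderiv_fderiv_slice_eq_zero_of_notMem_tsupport hz v w
  have vφi : ∀ (v : EuclideanSpace ℝ (Fin 3)) (z : ℝ × EuclideanSpace ℝ (Fin 3)), dist z.2 z₀.2 < ρ₁ →
      fderiv ℝ (φ z.1) z.2 v = 0 := fun v z hz => by rw [(hflat z.1 z.2 hz).1]; rfl
  have vφΔ : ∀ z : ℝ × EuclideanSpace ℝ (Fin 3), dist z.2 z₀.2 < ρ₁ → (Δ (φ z.1)) z.2 = 0 := fun z hz =>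
    (hflat z.1 z.2 hz).2.1
  have vφij : ∀ (v w : EuclideanSpace ℝ (Fin 3)) (z : ℝ × EuclideanSpace ℝ (Fin 3)), dist z.2 z₀.2 < ρ₁ →
      fderiv ℝ (fun y => fderiv ℝ (φ z.1) y v) z.2 w = 0 := fun v w z hz => (hflat z.1 z.2 hz).2.2 v w
  /- ### integrability of the data monomials on `K` -/
  have hu := hns.1
  have hu2 := hns.2.1
  have hp := hns.2.2.1
  have aeK : ∀ {P : ℝ × EuclideanSpace ℝ (Fin 3) → Prop},
      (∀ᵐ z ∂(volume.restrict (Ω : Set (ℝ × EuclideanSpace ℝ (Fin 3)))), P z) →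
        ∀ᵐ z ∂(volume.restrict K), P z :=
    fun h => ae_mono (Measure.restrict_mono hKΩ le_rfl) h
  have AEu : ∀ a : EuclideanSpace ℝ (Fin 3), ∀ᵐ z ∂(volume.restrict (Ω : Set (ℝ × EuclideanSpace ℝ (Fin 3)))),
      (⟪u z.1 z.2, a⟫ : ℝ) = ⟪ut z, a⟫ := fun a => by
    filter_upwards [hut] with z hz
    rw [hz]
  have AEuu : ∀ a a' : EuclideanSpace ℝ (Fin 3), ∀ᵐ z ∂(volume.restrict (Ω : Set (ℝ × EuclideanSpace ℝ (Fin 3)))),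
      (⟪u z.1 z.2, a⟫ : ℝ) * ⟪u z.1 z.2, a'⟫ = ⟪ut z, a⟫ * ⟪ut z, a'⟫ := fun a a' => by
    filter_upwards [hut] with z hz
    rw [hz]
  have AEp : ∀ᵐ z ∂(volume.restrict (Ω : Set (ℝ × EuclideanSpace ℝ (Fin 3)))), p z.1 z.2 = pt z := hpt
  have AEf : ∀ a : EuclideanSpace ℝ (Fin 3), ∀ᵐ z ∂(volume.restrict (Ω : Set (ℝ × EuclideanSpace ℝ (Fin 3)))),
      (⟪f z.1 z.2, a⟫ : ℝ) = ⟪ft z, a⟫ := fun a => by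
    filter_upwards [hft] with z hz
    rw [hz]
  have mu : ∀ a : EuclideanSpace ℝ (Fin 3),
      IntegrableOn (fun z : ℝ × EuclideanSpace ℝ (Fin 3) => ⟪u z.1 z.2, a⟫) K volume := fun a =>
    integrableOn_inner_of_locallyIntegrableOn hK hKΩ hu a
  have muu : ∀ a a' : EuclideanSpace ℝ (Fin 3), IntegrableOn
      (fun z : ℝ × EuclideanSpace ℝ (Fin 3) => ⟪u z.1 z.2, a⟫ * ⟪u z.1 z.2, a'⟫) K volume :=
    fun a a' => integrableOn_inner_mul_inner_of_locallyIntegrableOn hK hKΩ hu hu2 a a'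
  have mp : IntegrableOn (fun z : ℝ × EuclideanSpace ℝ (Fin 3) => p z.1 z.2) K volume :=
    hp.integrableOn_compact_subset hKΩ hK
  have mf : IntegrableOn (fun z : ℝ × EuclideanSpace ℝ (Fin 3) => ⟪f z.1 z.2, c⟫) K volume :=
    (hf.integrableOn_compact_subset hKΩ hK).inner_const c
  have mu' : ∀ a : EuclideanSpace ℝ (Fin 3),
      IntegrableOn (fun z : ℝ × EuclideanSpace ℝ (Fin 3) => ⟪ut z, a⟫) K volume := fun a =>
    (mu a).congr_fun_ae (aeK (AEu a))
  have muu' : ∀ a a' : EuclideanSpace ℝ (Fin 3), IntegrableOn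
      (fun z : ℝ × EuclideanSpace ℝ (Fin 3) => ⟪ut z, a⟫ * ⟪ut z, a'⟫) K volume :=
    fun a a' => (muu a a').congr_fun_ae (aeK (AEuu a a'))
  have mp' : IntegrableOn pt K volume := mp.congr_fun_ae (aeK AEp)
  have mf' : IntegrableOn (fun z : ℝ × EuclideanSpace ℝ (Fin 3) => ⟪ft z, c⟫) K volume :=
    mf.congr_fun_ae (aeK (AEf c))
  -- measurability of the modified monomials
  have meu : ∀ a : EuclideanSpace ℝ (Fin 3), Measurable fun z : ℝ × EuclideanSpace ℝ (Fin 3) => (⟪ut z, a⟫ : ℝ) :=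
    fun a => hutm.inner measurable_const
  have meuu : ∀ a a' : EuclideanSpace ℝ (Fin 3),
      Measurable fun z : ℝ × EuclideanSpace ℝ (Fin 3) => (⟪ut z, a⟫ : ℝ) * ⟪ut z, a'⟫ :=
    fun a a' => (meu a).mul (meu a')
  /- ### generic tools -/
  have INT : ∀ {T m X : ℝ × EuclideanSpace ℝ (Fin 3) → ℝ}, Continuous T → (∀ z, z ∉ K → T z = 0) →
      IntegrableOn m K volume → Continuous X →
      IntegrableOn (fun z => T z * m z * X z) (Ω : Set (ℝ × EuclideanSpace ℝ (Fin 3))) volume :=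
    fun hT hT0 hm hX => integrableOn_test_mul_mul Ω hK hT hT0 hm hX
  have CONV : ∀ (T m m' X : ℝ × EuclideanSpace ℝ (Fin 3) → ℝ), (∀ z, z ∉ K → T z = 0) →
      (∀ᵐ z ∂(volume.restrict (Ω : Set (ℝ × EuclideanSpace ℝ (Fin 3)))), m z = m' z) →
      ∫ z in (Ω : Set (ℝ × EuclideanSpace ℝ (Fin 3))), T z * m z * X z = ∫ z, (T z * m' z) * X z :=
    fun T m m' X hT0 hmm' => setIntegral_coeff_mul_eq_integral_modification hΩm hKΩ hT0 hmm'
  have FINT : ∀ (T m' : ℝ × EuclideanSpace ℝ (Fin 3) → ℝ), Continuous T → (∀ z, z ∉ K → T z = 0) →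
      IntegrableOn m' K volume → Integrable (fun z => T z * m' z) volume :=
    fun T m' hT hT0 hm => integrable_coeff_mul hK hT hT0 hm
  have FSUPP : ∀ (T m' : ℝ × EuclideanSpace ℝ (Fin 3) → ℝ), (∀ z, z ∉ K → T z = 0) →
      ∀ᵐ z ∂(volume : Measure (ℝ × EuclideanSpace ℝ (Fin 3))), T z * m' z ≠ 0 → z.1 ∈ Icc a₀ b₀ :=
    fun T m' hT0 => Eventually.of_forall fun z hz => hKt z (by
      by_contra h
      exact hz (by rw [hT0 z h, zero_mul]))
  have ANN : ∀ (T m' : ℝ × EuclideanSpace ℝ (Fin 3) → ℝ),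
      (∀ z : ℝ × EuclideanSpace ℝ (Fin 3), dist z.2 z₀.2 < ρ₁ → T z = 0) →
      ∀ z, T z * m' z ≠ 0 → z.2 ∈ {y : EuclideanSpace ℝ (Fin 3) | ρ₁ ≤ dist y z₀.2} :=
    fun T m' hT z hz => by
      by_contra h
      rw [mem_setOf_eq, not_le] at h
      exact hz (by rw [hT z h, zero_mul])
  have MEAS : ∀ (T m' : ℝ × EuclideanSpace ℝ (Fin 3) → ℝ), Continuous T → Measurable m' →
      Measurable fun z => T z * m' z := fun T m' hT hm => hT.measurable.mul hm
  /- ### integrability of the twelve families on `Ω` -/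
  have iA1 : IntegrableOn (fun z : ℝ × EuclideanSpace ℝ (Fin 3) =>
      (timeDeriv φ z.1 z.2 + ν * (Δ (φ z.1)) z.2) * ⟪u z.1 z.2, c⟫ * η z.1 z.2) Ω volume :=
    INT (cφt.add (continuous_const.mul cφΔ)) zφt (mu c) cη
  have iA2 : ∀ i, IntegrableOn (fun z : ℝ × EuclideanSpace ℝ (Fin 3) =>
      (2 * ν * fderiv ℝ (φ z.1) z.2 (b i)) * ⟪u z.1 z.2, c⟫ * fderiv ℝ (η z.1) z.2 (b i)) Ω volume :=
    fun i =>
    INT (continuous_const.mul (cφi (b i))) (fun z hz => by rw [zφi (b i) z hz, mul_zero]) (mu c) (cηi (b i))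
  have iA3 : ∀ i, IntegrableOn (fun z : ℝ × EuclideanSpace ℝ (Fin 3) =>
      fderiv ℝ (φ z.1) z.2 (b i) * (⟪u z.1 z.2, b i⟫ * ⟪u z.1 z.2, c⟫) * η z.1 z.2) Ω volume := fun i =>
    INT (cφi (b i)) (zφi (b i)) (muu (b i) c) cη
  have iA4 : ∀ i, IntegrableOn (fun z : ℝ × EuclideanSpace ℝ (Fin 3) =>
      φ z.1 z.2 * (⟪u z.1 z.2, b i⟫ * ⟪u z.1 z.2, c⟫) * fderiv ℝ (η z.1) z.2 (b i)) Ω volume := fun i =>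
    INT cφ zφ (muu (b i) c) (cηi (b i))
  have iA5 : IntegrableOn (fun z : ℝ × EuclideanSpace ℝ (Fin 3) =>
      fderiv ℝ (φ z.1) z.2 c * p z.1 z.2 * η z.1 z.2) Ω volume := INT (cφi c) (zφi c) mp cη
  have iA6 : IntegrableOn (fun z : ℝ × EuclideanSpace ℝ (Fin 3) =>
      φ z.1 z.2 * ⟪f z.1 z.2, c⟫ * η z.1 z.2) Ω volume := INT cφ zφ mf cη
  have iB1 : IntegrableOn (fun z : ℝ × EuclideanSpace ℝ (Fin 3) => φ z.1 z.2 * p z.1 z.2 * L z.1 z.2) Ω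
      volume := INT cφ zφ mp cL
  have iB2 : IntegrableOn (fun z : ℝ × EuclideanSpace ℝ (Fin 3) =>
      (-(Δ (φ z.1)) z.2) * p z.1 z.2 * Ξ z.1 z.2) Ω volume :=
    INT cφΔ.neg (fun z hz => by rw [laplacian_slice_eq_zero_of_notMem_tsupport hz, neg_zero]) mp cΞ
  have iB3 : ∀ i, IntegrableOn (fun z : ℝ × EuclideanSpace ℝ (Fin 3) =>
      (-(2 * fderiv ℝ (φ z.1) z.2 (b i))) * p z.1 z.2 * fderiv ℝ (Ξ z.1) z.2 (b i)) Ω volume := fun i =>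
    INT (continuous_const.mul (cφi (b i))).neg
      (fun z hz => by rw [zφi (b i) z hz, mul_zero, neg_zero]) mp (cΞi (b i))
  have iB4 : ∀ i j, IntegrableOn (fun z : ℝ × EuclideanSpace ℝ (Fin 3) =>
      (-(φ z.1 z.2)) * (⟪u z.1 z.2, b i⟫ * ⟪u z.1 z.2, b j⟫) *
        fderiv ℝ (fun y => fderiv ℝ (Ξ z.1) y (b i)) z.2 (b j)) Ω volume := fun i j =>
    INT cφ.neg (fun z hz => by rw [zφ z hz, neg_zero]) (muu (b i) (b j)) (cΞij (b i) (b j))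
  have iB5 : ∀ i j, IntegrableOn (fun z : ℝ × EuclideanSpace ℝ (Fin 3) =>
      (-(fderiv ℝ (fun y => fderiv ℝ (φ z.1) y (b i)) z.2 (b j))) * (⟪u z.1 z.2, b i⟫ * ⟪u z.1 z.2, b j⟫) *
        Ξ z.1 z.2) Ω volume := fun i j =>
    INT (cφij (b i) (b j)).neg (fun z hz => by rw [zφij (b i) (b j) z hz, neg_zero])
      (muu (b i) (b j)) cΞ
  have iB6 : ∀ i j, IntegrableOn (fun z : ℝ × EuclideanSpace ℝ (Fin 3) =>
      (-(2 * fderiv ℝ (φ z.1) z.2 (b j))) * (⟪u z.1 z.2, b j⟫ * ⟪u z.1 z.2, b i⟫) *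
        fderiv ℝ (Ξ z.1) z.2 (b i)) Ω volume := fun i j =>
    INT (continuous_const.mul (cφi (b j))).neg
      (fun z hz => by rw [zφi (b j) z hz, mul_zero, neg_zero]) (muu (b j) (b i)) (cΞi (b i))
  have iA2s : IntegrableOn (fun z : ℝ × EuclideanSpace ℝ (Fin 3) =>
      ∑ i, (2 * ν * fderiv ℝ (φ z.1) z.2 (b i)) * ⟪u z.1 z.2, c⟫ * fderiv ℝ (η z.1) z.2 (b i)) Ω volume :=
    integrable_finsetSum _ fun i _ => iA2 i
  have iA3s : IntegrableOn (fun z : ℝ × EuclideanSpace ℝ (Fin 3) =>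
      ∑ i, fderiv ℝ (φ z.1) z.2 (b i) * (⟪u z.1 z.2, b i⟫ * ⟪u z.1 z.2, c⟫) * η z.1 z.2) Ω volume :=
    integrable_finsetSum _ fun i _ => iA3 i
  have iA4s : IntegrableOn (fun z : ℝ × EuclideanSpace ℝ (Fin 3) =>
      ∑ i, φ z.1 z.2 * (⟪u z.1 z.2, b i⟫ * ⟪u z.1 z.2, c⟫) * fderiv ℝ (η z.1) z.2 (b i)) Ω volume :=
    integrable_finsetSum _ fun i _ => iA4 i
  have iB3s : IntegrableOn (fun z : ℝ × EuclideanSpace ℝ (Fin 3) =>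
      ∑ i, (-(2 * fderiv ℝ (φ z.1) z.2 (b i))) * p z.1 z.2 * fderiv ℝ (Ξ z.1) z.2 (b i)) Ω volume :=
    integrable_finsetSum _ fun i _ => iB3 i
  have iB4s : IntegrableOn (fun z : ℝ × EuclideanSpace ℝ (Fin 3) =>
      ∑ i, ∑ j, (-(φ z.1 z.2)) * (⟪u z.1 z.2, b i⟫ * ⟪u z.1 z.2, b j⟫) *
        fderiv ℝ (fun y => fderiv ℝ (Ξ z.1) y (b i)) z.2 (b j)) Ω volume :=
    integrable_finsetSum _ fun i _ => integrable_finsetSum _ fun j _ => iB4 i j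
  have iB5s : IntegrableOn (fun z : ℝ × EuclideanSpace ℝ (Fin 3) =>
      ∑ i, ∑ j, (-(fderiv ℝ (fun y => fderiv ℝ (φ z.1) y (b i)) z.2 (b j))) *
        (⟪u z.1 z.2, b i⟫ * ⟪u z.1 z.2, b j⟫) * Ξ z.1 z.2) Ω volume :=
    integrable_finsetSum _ fun i _ => integrable_finsetSum _ fun j _ => iB5 i j
  have iB6s : IntegrableOn (fun z : ℝ × EuclideanSpace ℝ (Fin 3) =>
      ∑ i, ∑ j, (-(2 * fderiv ℝ (φ z.1) z.2 (b j))) * (⟪u z.1 z.2, b j⟫ * ⟪u z.1 z.2, b i⟫) *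
        fderiv ℝ (Ξ z.1) z.2 (b i)) Ω volume :=
    integrable_finsetSum _ fun i _ => integrable_finsetSum _ fun j _ => iB6 i j
  /- ### splitting the two integrals -/
  rw [integral_add ((((iA1.fun_add iA2s).fun_add iA3s).fun_add iA4s).fun_add iA5) iA6,
    integral_add (((iA1.fun_add iA2s).fun_add iA3s).fun_add iA4s) iA5,
    integral_add ((iA1.fun_add iA2s).fun_add iA3s) iA4s,
    integral_add (iA1.fun_add iA2s) iA3s, integral_add iA1 iA2s,
    integral_finsetSum _ (fun i _ => iA2 i), integral_finsetSum _ (fun i _ => iA3 i),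
    integral_finsetSum _ (fun i _ => iA4 i)]
  rw [integral_add ((((iB1.fun_add iB2).fun_add iB3s).fun_add iB4s).fun_add iB5s) iB6s,
    integral_add (((iB1.fun_add iB2).fun_add iB3s).fun_add iB4s) iB5s,
    integral_add ((iB1.fun_add iB2).fun_add iB3s) iB4s,
    integral_add (iB1.fun_add iB2) iB3s, integral_add iB1 iB2,
    integral_finsetSum _ (fun i _ => iB3 i),
    integral_finsetSum _ (fun i _ => integrable_finsetSum _ fun j _ => iB4 i j),
    integral_finsetSum _ (fun i _ => integrable_finsetSum _ fun j _ => iB5 i j),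
    integral_finsetSum _ (fun i _ => integrable_finsetSum _ fun j _ => iB6 i j)]
  simp_rw [integral_finsetSum _ (fun j _ => iB4 _ j), integral_finsetSum _ (fun j _ => iB5 _ j),
    integral_finsetSum _ (fun j _ => iB6 _ j)]
  /- ### the twelve conversions (coefficient `T`, original datum `m`, modified datum `m'`, field `X`) -/
  -- the coefficients
  let T1 : ℝ × EuclideanSpace ℝ (Fin 3) → ℝ := fun z => timeDeriv φ z.1 z.2 + ν * (Δ (φ z.1)) z.2
  let T2 : Fin 3 → ℝ × EuclideanSpace ℝ (Fin 3) → ℝ := fun i z => 2 * ν * fderiv ℝ (φ z.1) z.2 (b i)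
  let T3 : Fin 3 → ℝ × EuclideanSpace ℝ (Fin 3) → ℝ := fun i z => fderiv ℝ (φ z.1) z.2 (b i)
  let T4 : ℝ × EuclideanSpace ℝ (Fin 3) → ℝ := fun z => φ z.1 z.2
  let T5 : ℝ × EuclideanSpace ℝ (Fin 3) → ℝ := fun z => fderiv ℝ (φ z.1) z.2 c
  let T8 : ℝ × EuclideanSpace ℝ (Fin 3) → ℝ := fun z => -(Δ (φ z.1)) z.2
  let T9 : Fin 3 → ℝ × EuclideanSpace ℝ (Fin 3) → ℝ := fun i z => -(2 * fderiv ℝ (φ z.1) z.2 (b i))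
  let T10 : ℝ × EuclideanSpace ℝ (Fin 3) → ℝ := fun z => -(φ z.1 z.2)
  let T11 : Fin 3 → Fin 3 → ℝ × EuclideanSpace ℝ (Fin 3) → ℝ := fun i j z =>
    -(fderiv ℝ (fun y => fderiv ℝ (φ z.1) y (b i)) z.2 (b j))
  -- their continuity and vanishing
  have cT1 : Continuous T1 := cφt.add (continuous_const.mul cφΔ)
  have cT2 : ∀ i, Continuous (T2 i) := fun i => continuous_const.mul (cφi (b i))
  have cT3 : ∀ i, Continuous (T3 i) := fun i => cφi (b i)
  have cT4 : Continuous T4 := cφ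
  have cT5 : Continuous T5 := cφi c
  have cT8 : Continuous T8 := cφΔ.neg
  have cT9 : ∀ i, Continuous (T9 i) := fun i => (continuous_const.mul (cφi (b i))).neg
  have cT10 : Continuous T10 := cφ.neg
  have cT11 : ∀ i j, Continuous (T11 i j) := fun i j => (cφij (b i) (b j)).neg
  have zT1 : ∀ z, z ∉ K → T1 z = 0 := zφt
  have zT2 : ∀ i z, z ∉ K → T2 i z = 0 := fun i z hz => by simp only [T2]; rw [zφi (b i) z hz, mul_zero]
  have zT3 : ∀ i z, z ∉ K → T3 i z = 0 := fun i z hz => zφi (b i) z hz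
  have zT4 : ∀ z, z ∉ K → T4 z = 0 := zφ
  have zT5 : ∀ z, z ∉ K → T5 z = 0 := zφi c
  have zT8 : ∀ z, z ∉ K → T8 z = 0 := fun z hz => by
    simp only [T8]; rw [laplacian_slice_eq_zero_of_notMem_tsupport hz, neg_zero]
  have zT9 : ∀ i z, z ∉ K → T9 i z = 0 := fun i z hz => by simp only [T9]; rw [zφi (b i) z hz, mul_zero, neg_zero]
  have zT10 : ∀ z, z ∉ K → T10 z = 0 := fun z hz => by simp only [T10]; rw [zφ z hz, neg_zero]
  have zT11 : ∀ i j z, z ∉ K → T11 i j z = 0 := fun i j z hz => by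
    simp only [T11]; rw [zφij (b i) (b j) z hz, neg_zero]
  have aT5 : ∀ z : ℝ × EuclideanSpace ℝ (Fin 3), dist z.2 z₀.2 < ρ₁ → T5 z = 0 := fun z hz => vφi c z hz
  have aT8 : ∀ z : ℝ × EuclideanSpace ℝ (Fin 3), dist z.2 z₀.2 < ρ₁ → T8 z = 0 := fun z hz => by simp only [T8]; rw [vφΔ z hz, neg_zero]
  have aT9 : ∀ i (z : ℝ × EuclideanSpace ℝ (Fin 3)), dist z.2 z₀.2 < ρ₁ → T9 i z = 0 := fun i z hz => by
    simp only [T9]; rw [vφi (b i) z hz, mul_zero, neg_zero]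
  have aT11 : ∀ i j (z : ℝ × EuclideanSpace ℝ (Fin 3)), dist z.2 z₀.2 < ρ₁ → T11 i j z = 0 := fun i j z hz => by
    simp only [T11]; rw [vφij (b i) (b j) z hz]; simp
  -- the data
  let mu0 : ℝ × EuclideanSpace ℝ (Fin 3) → ℝ := fun z => ⟪u z.1 z.2, c⟫
  set mu0' : ℝ × EuclideanSpace ℝ (Fin 3) → ℝ := fun z => ⟪ut z, c⟫ with hmu0'
  let muu0 : Fin 3 → Fin 3 → ℝ × EuclideanSpace ℝ (Fin 3) → ℝ := fun i j z => ⟪u z.1 z.2, b i⟫ * ⟪u z.1 z.2, b j⟫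
  set muu0' : Fin 3 → Fin 3 → ℝ × EuclideanSpace ℝ (Fin 3) → ℝ := fun i j z => ⟪ut z, b i⟫ * ⟪ut z, b j⟫ with hmuu0'
  let muc : Fin 3 → ℝ × EuclideanSpace ℝ (Fin 3) → ℝ := fun i z => ⟪u z.1 z.2, b i⟫ * ⟪u z.1 z.2, c⟫
  set muc' : Fin 3 → ℝ × EuclideanSpace ℝ (Fin 3) → ℝ := fun i z => ⟪ut z, b i⟫ * ⟪ut z, c⟫ with hmuc'
  let mp0 : ℝ × EuclideanSpace ℝ (Fin 3) → ℝ := fun z => p z.1 z.2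
  let mf0 : ℝ × EuclideanSpace ℝ (Fin 3) → ℝ := fun z => ⟪f z.1 z.2, c⟫
  set mf0' : ℝ × EuclideanSpace ℝ (Fin 3) → ℝ := fun z => ⟪ft z, c⟫ with hmf0'
  -- the fields
  let Xη : ℝ × EuclideanSpace ℝ (Fin 3) → ℝ := fun z => η z.1 z.2
  let Xηi : Fin 3 → ℝ × EuclideanSpace ℝ (Fin 3) → ℝ := fun i z => fderiv ℝ (η z.1) z.2 (b i)
  let XΞ : ℝ × EuclideanSpace ℝ (Fin 3) → ℝ := fun z => Ξ z.1 z.2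
  let XΞi : Fin 3 → ℝ × EuclideanSpace ℝ (Fin 3) → ℝ := fun i z => fderiv ℝ (Ξ z.1) z.2 (b i)
  let XΞij : Fin 3 → Fin 3 → ℝ × EuclideanSpace ℝ (Fin 3) → ℝ := fun i j z => fderiv ℝ (fun y => fderiv ℝ (Ξ z.1) y (b i)) z.2 (b j)
   
  let XL : ℝ × EuclideanSpace ℝ (Fin 3) → ℝ := fun z => L z.1 z.2
  -- T1
  have e1 : ∫ z in (Ω : Set (ℝ × EuclideanSpace ℝ (Fin 3))), (timeDeriv φ z.1 z.2 + ν * (Δ (φ z.1)) z.2) * ⟪u z.1 z.2, c⟫ * η z.1 z.2 =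
      ∫ w : ℝ × EuclideanSpace ℝ (Fin 3), θ w.1 w.2 * heatPotential ν (fun z => (timeDeriv φ z.1 z.2 + ν * (Δ (φ z.1)) z.2) * ⟪ut z, c⟫) w :=
    (CONV T1 mu0 mu0' Xη zT1 (AEu c)).trans
      (pairing_heatDuhamelBack_eq hg hν (FINT T1 mu0' cT1 zT1 (mu' c)) (FSUPP T1 mu0' zT1))
  -- T2
  have e2 : ∀ i, ∫ z in (Ω : Set (ℝ × EuclideanSpace ℝ (Fin 3))), (2 * ν * fderiv ℝ (φ z.1) z.2 (b i)) * ⟪u z.1 z.2, c⟫ * fderiv ℝ (η z.1) z.2 (b i) =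
      ∫ w : ℝ × EuclideanSpace ℝ (Fin 3), θ w.1 w.2 * (-(multiplierHeatPotential ν (derivSymbol (b i)) (fun z => (2 * ν * fderiv ℝ (φ z.1) z.2 (b i)) * ⟪ut z, c⟫) w).re) :=
    fun i => (CONV (T2 i) mu0 mu0' (Xηi i) (zT2 i) (AEu c)).trans
      (pairing_fderiv_heatDuhamelBack_eq hg hν (FINT (T2 i) mu0' (cT2 i) (zT2 i) (mu' c))
        (FSUPP (T2 i) mu0' (zT2 i)) (b i))
  -- T3
  have e3 : ∀ i, ∫ z in (Ω : Set (ℝ × EuclideanSpace ℝ (Fin 3))), fderiv ℝ (φ z.1) z.2 (b i) * (⟪u z.1 z.2, b i⟫ * ⟪u z.1 z.2, c⟫) * η z.1 z.2 =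
      ∫ w : ℝ × EuclideanSpace ℝ (Fin 3), θ w.1 w.2 * heatPotential ν (fun z => fderiv ℝ (φ z.1) z.2 (b i) * (⟪ut z, b i⟫ * ⟪ut z, c⟫)) w := fun i =>
    (CONV (T3 i) (muc i) (muc' i) Xη (zT3 i) (AEuu (b i) c)).trans
      (pairing_heatDuhamelBack_eq hg hν (FINT (T3 i) (muc' i) (cT3 i) (zT3 i) (muu' (b i) c))
        (FSUPP (T3 i) (muc' i) (zT3 i)))
  -- T4
  have e4 : ∀ i, ∫ z in (Ω : Set (ℝ × EuclideanSpace ℝ (Fin 3))), φ z.1 z.2 * (⟪u z.1 z.2, b i⟫ * ⟪u z.1 z.2, c⟫) * fderiv ℝ (η z.1) z.2 (b i) =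
      ∫ w : ℝ × EuclideanSpace ℝ (Fin 3), θ w.1 w.2 * (-(multiplierHeatPotential ν (derivSymbol (b i)) (fun z => φ z.1 z.2 * (⟪ut z, b i⟫ * ⟪ut z, c⟫)) w).re) :=
    fun i => (CONV T4 (muc i) (muc' i) (Xηi i) zT4 (AEuu (b i) c)).trans
      (pairing_fderiv_heatDuhamelBack_eq hg hν (FINT T4 (muc' i) cT4 zT4 (muu' (b i) c))
        (FSUPP T4 (muc' i) zT4) (b i))
  -- T5 (far field)
  have e5 : ∫ z in (Ω : Set (ℝ × EuclideanSpace ℝ (Fin 3))), fderiv ℝ (φ z.1) z.2 c * p z.1 z.2 * η z.1 z.2 =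
      ∫ w : ℝ × EuclideanSpace ℝ (Fin 3), θ w.1 w.2 * ∫ z, (fun v => backKernel
        (fun a y => UnboundedOperators.heatKernel (E := EuclideanSpace ℝ (Fin 3)) (ν * a) y) (-v)) (w - z) *
          (fderiv ℝ (φ z.1) z.2 c * pt z) :=
    (CONV T5 mp0 pt Xη zT5 AEp).trans
      (pairing_heatDuhamelBack_eq_reflect hg hν (FINT T5 pt cT5 zT5 mp') (FSUPP T5 pt zT5))
  -- T6
  have e6 : ∫ z in (Ω : Set (ℝ × EuclideanSpace ℝ (Fin 3))), φ z.1 z.2 * ⟪f z.1 z.2, c⟫ * η z.1 z.2 =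
      ∫ w : ℝ × EuclideanSpace ℝ (Fin 3), θ w.1 w.2 * heatPotential ν (fun z => φ z.1 z.2 * ⟪ft z, c⟫) w :=
    (CONV T4 mf0 mf0' Xη zT4 (AEf c)).trans
      (pairing_heatDuhamelBack_eq hg hν (FINT T4 mf0' cT4 zT4 mf') (FSUPP T4 mf0' zT4))
  -- T7
  have e7 : ∫ z in (Ω : Set (ℝ × EuclideanSpace ℝ (Fin 3))), φ z.1 z.2 * p z.1 z.2 * L z.1 z.2 =
      ∫ w : ℝ × EuclideanSpace ℝ (Fin 3), θ w.1 w.2 * heatPotential ν (fun q : ℝ × EuclideanSpace ℝ (Fin 3) =>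
        ∫ y, fderiv ℝ (newtonFarLaplacian r₀ r₁) (y - q.2) c * (φ q.1 y * pt (q.1, y))) w :=
    (CONV T4 mp0 pt XL zT4 AEp).trans
      (pairing_newtonFarSmoothing_eq hg hν (FINT T4 pt cT4 zT4 mp') h₀ h₁ (MEAS T4 pt cT4 hptm) c)
  -- T8 (far field)
  have e8 : ∫ z in (Ω : Set (ℝ × EuclideanSpace ℝ (Fin 3))), (-(Δ (φ z.1)) z.2) * p z.1 z.2 * Ξ z.1 z.2 =
      ∫ w : ℝ × EuclideanSpace ℝ (Fin 3), θ w.1 w.2 * ∫ z, (fun v => backKernel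
        (fun a y => heatD1 (ν * a) c (newtonNear r₀ r₁) y) (-v)) (w - z) * ((-(Δ (φ z.1)) z.2) * pt z) :=
    (CONV T8 mp0 pt XΞ zT8 AEp).trans
      (pairing_newtonNear_eq_reflect hg hν (FINT T8 pt cT8 zT8 mp') (FSUPP T8 pt zT8) h₀ h₁ c)
  -- T9 (far field, separated)
  have e9 : ∀ i, ∫ z in (Ω : Set (ℝ × EuclideanSpace ℝ (Fin 3))), (-(2 * fderiv ℝ (φ z.1) z.2 (b i))) * p z.1 z.2 * fderiv ℝ (Ξ z.1) z.2 (b i) =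
      ∫ w : ℝ × EuclideanSpace ℝ (Fin 3), θ w.1 w.2 * ∫ z, (fun v => backKernel
        (fun a y => heatD2 (ν * a) (b i) c (newtonNear r₀ r₁) y) (-v)) (w - z) * ((-(2 * fderiv ℝ (φ z.1) z.2 (b i))) * pt z) := fun i =>
    (CONV (T9 i) mp0 pt (XΞi i) (zT9 i) AEp).trans
      (pairing_fderiv_newtonNear_eq_reflect hg hν (FINT (T9 i) pt (cT9 i) (zT9 i) mp')
        h₀ h₁ (b i) c hδ hgA hsep (Eventually.of_forall (ANN (T9 i) pt (aT9 i))) (ANN (T9 i) pt (aT9 i)))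
  -- T10 (Oseen multiplier + smooth remainder)
  have e10 : ∀ i j, ∫ z in (Ω : Set (ℝ × EuclideanSpace ℝ (Fin 3))), (-(φ z.1 z.2)) * (⟪u z.1 z.2, b i⟫ * ⟪u z.1 z.2, b j⟫) * fderiv ℝ (fun y => fderiv ℝ (Ξ z.1) y (b i)) z.2 (b j) =
      ∫ w : ℝ × EuclideanSpace ℝ (Fin 3), θ w.1 w.2 *
        (-(multiplierHeatPotential ν (oseenSymbol (b j) (b i) c) (fun z => (-(φ z.1 z.2)) * (⟪ut z, b i⟫ * ⟪ut z, b j⟫)) w).re +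
        heatPotential ν (fun q : ℝ × EuclideanSpace ℝ (Fin 3) =>
          ∫ y, newtonFarD3Profile r₀ r₁ (b j) (b i) c (y - q.2) * ((-(φ q.1 y)) * (⟪ut (q.1, y), b i⟫ * ⟪ut (q.1, y), b j⟫))) w) :=
    fun i j => (CONV T10 (muu0 i j) (muu0' i j) (XΞij i j) zT10 (AEuu (b i) (b j))).trans
      (pairing_fderiv_fderiv_newtonNear_eq hg hν (FINT T10 (muu0' i j) cT10 zT10 (muu' (b i) (b j)))
        h₀ h₁ (MEAS T10 (muu0' i j) cT10 (meuu (b i) (b j))) (FSUPP T10 (muu0' i j) zT10)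
        (hb1 j) (hb1 i) hc1)
  -- T11 (far field)
  have e11 : ∀ i j, ∫ z in (Ω : Set (ℝ × EuclideanSpace ℝ (Fin 3))), (-(fderiv ℝ (fun y => fderiv ℝ (φ z.1) y (b i)) z.2 (b j))) * (⟪u z.1 z.2, b i⟫ * ⟪u z.1 z.2, b j⟫) * Ξ z.1 z.2 =
      ∫ w : ℝ × EuclideanSpace ℝ (Fin 3), θ w.1 w.2 * ∫ z, (fun v => backKernel
        (fun a y => heatD1 (ν * a) c (newtonNear r₀ r₁) y) (-v)) (w - z) * ((-(fderiv ℝ (fun y => fderiv ℝ (φ z.1) y (b i)) z.2 (b j))) * (⟪ut z, b i⟫ * ⟪ut z, b j⟫)) :=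
    fun i j => (CONV (T11 i j) (muu0 i j) (muu0' i j) XΞ (zT11 i j) (AEuu (b i) (b j))).trans
      (pairing_newtonNear_eq_reflect hg hν (FINT (T11 i j) (muu0' i j) (cT11 i j) (zT11 i j) (muu' (b i) (b j)))
        (FSUPP (T11 i j) (muu0' i j) (zT11 i j)) h₀ h₁ c)
  -- T12 (far field, separated)
  have e12 : ∀ i j, ∫ z in (Ω : Set (ℝ × EuclideanSpace ℝ (Fin 3))), (-(2 * fderiv ℝ (φ z.1) z.2 (b j))) * (⟪u z.1 z.2, b j⟫ * ⟪u z.1 z.2, b i⟫) * fderiv ℝ (Ξ z.1) z.2 (b i) =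
      ∫ w : ℝ × EuclideanSpace ℝ (Fin 3), θ w.1 w.2 * ∫ z, (fun v => backKernel
        (fun a y => heatD2 (ν * a) (b i) c (newtonNear r₀ r₁) y) (-v)) (w - z) * ((-(2 * fderiv ℝ (φ z.1) z.2 (b j))) * (⟪ut z, b j⟫ * ⟪ut z, b i⟫)) :=
    fun i j => (CONV (T9 j) (muu0 j i) (muu0' j i) (XΞi i) (zT9 j) (AEuu (b j) (b i))).trans
      (pairing_fderiv_newtonNear_eq_reflect hg hν
        (FINT (T9 j) (muu0' j i) (cT9 j) (zT9 j) (muu' (b j) (b i)))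
        h₀ h₁ (b i) c hδ hgA hsep (Eventually.of_forall (ANN (T9 j) (muu0' j i) (aT9 j)))
        (ANN (T9 j) (muu0' j i) (aT9 j)))
  /- ### conclusion -/
  rw [e1, e5, e6, e7, e8]
  simp only [e2, e3, e4, e9, e10, e11, e12]
  ring

end Literature.Analysis.FluidPDE
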